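import Literature.AnabelianGeometry.EtaleTheta.Discharge.Sec3Thm37OfRankOneObjectR
import Literature.AnabelianGeometry.EtaleTheta.Discharge.Sec3Cor38OfTowerR
import Literature.AnabelianGeometry.EtaleTheta.Discharge.Sec3EffRealSpanKummerTwistTower
import Literature.AnabelianGeometry.EtaleTheta.Discharge.Sec3Prop34Cnst0KummerTwistTower
import HarnessLib

/-!
# [EtTh] Theorem 3.7 (i)–(iv) and Corollary 3.8 (i) ∧ (ii) ∧ (iii), monoid type `Λ = ℝ`, at the ζ-TWISTED Kummer–Tate tower with NO binder —
# Thm. 3.7 (iii) read through the NON-CONSTANT constant-field functor `D^cnst : Y ↦ Spec K_Y`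

S. Mochizuki, *The étale theta function and its Frobenioid-theoretic manifestations*, Publ. RIMS **45** (2009), Thm. 3.7 (i)–(iv) PDF
pp.79–80 («(iii) … the natural action of `Aut_C(A)` on `O^▷(A)`, `O^×(A)` factors through `Aut_{D^cnst}(A^cnst)`»), Cor. 3.8 (i)–(iii)
pp.80–81, Prop. 3.4 (ii) p.74, Def. 3.6 (i)/(ii) pp.76–77 (`Λ = ℝ`: `B₀^ℝ := ℝ·Φ₀^birat`, `F₀^ℝ := ℝ·Φ₀^cnst`)
[cite: MochizukiEtTh2009, Thm 3.7 p.79]; [FrdI] Thm. 5.2 p.100 [cite: MochizukiFrdI2008, Thm. 5.2 p.100].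

PROOF-ONLY (theorems only; abc-iut cell, layer L2; abc-iut-L2-lead row R914/R936/R986 «PROP34CNST₀ WITH NON-CONSTANT `D^cnst` AT THE TWISTED
TOWER», holder abc-iut-w6-d057 gen 4, file F3 = the `Λ = ℝ` payoff).  At abc-iut-L2-d2's ζ-twisted tower `towerC` (p478618) — the third
model of record, the first whose constant fields carry roots of unity MOVED by the Galois group — Thm. 3.7 (iii) cannot be read through a
CONSTANT `D^cnst` (`not_prop34Cnst₀_const`, p483973).  The spec-of-record functor `TateTowerKummerTwist.cnst : Y ↦ Spec K_Y = C/Gal(K̄/K_Y)`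
(abc-iut-w5-d179 gen 8, p489246) satisfies abc-iut-L2-t3's `Prop34Cnst₀` (`prop34Cnst₀_cnst`, abc-iut-w5-d179's
`Sec3Prop34Cnst0KummerTwistTower`), the `Λ = ℝ` effective-locus clause holds (`effRealSpan_ofTowerC`, this seat's
`Sec3EffRealSpanKummerTwistTower`), and `Prop34Const` holds (`prop34ConstC`, abc-iut-L2-d2 p482744); feeding abc-iut-L2-d2 gen 5's
`dm`-generic engines `thm37_ofRankOneObjectR_of_inputs` / `cor38_i_ii_ofRankOneObjectR_ofTower` / `hull_selfEquivalence_ofRankOneObjectR_ofTower`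
and the `Λ = ℝ` apex `cor38_iii_ofRlfRWeak_of_isFrobenioid_of_countable_of_prop34Const` at the rank-one object `rankOneObjectC` (p481604):
* §1 `G_K = C = ∏ₙ(ℤ/Mₙ)ˣ` IS compact (`compactSpace_cst`: Mathlib does not infer `Finite (ℤ/(n+2)!)` without `NeZero ((n+2)!)`, supplied
  here; no instance declared) and `hcnt` at the `Λ = ℝ` rank-one-object Frobenioid of the twisted tower;
* §2 **`thm37_kummerTwistR`** — [EtTh] Thm. 3.7 (i) ∧ (ii) ∧ (iii) ∧ (iv), `Λ = ℝ`, at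
  `TemperedFrobenioid.ofRankOneObjectR rankOneObjectC hpfC R S`, NO binder, with (iii) = `AutActionFactorsThrough (base ⋙ cnst)` for the
  NON-CONSTANT `cnst` (its automorphism groups `Aut_{D^cnst}(Y^cnst) = Gal(K_Y/K)` are non-trivial: `cnst_map_deck_ne_id`);
* §3 **`cor38_kummerTwistR (h) : Cor38_i ∧ Cor38_ii ∧ Cor38_iii h`**, `Λ = ℝ`, for every Cor. 3.8 datum between two such Frobenioids, NO
  binder beyond `h`; its conclusions, the `∃`-form (`Ψ := 𝟭`), and Cor. 3.8 (ii) for every self-equivalence.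
HONEST LABEL: instantiation / consistency certificates at a CONSTRUCTED class-(b) design model (`D` one object over the one-point covering;
`D^cnst = 𝓑(C)⁰` with `C` the model's cyclotomic-character group) — NOT the tempered Frobenioid of a Tate curve; refereed pre-IUT material;
nothing here bears on [IUTchIII] Cor. 3.12; no side taken; typed ≠ proved — here proved.
-/

noncomputable section

namespace Literature.AnabelianGeometry.EtaleTheta

open CategoryTheory Opposite Function Literature.AlgebraicGeometry.Frobenioids Literature.AnabelianGeometry.SemiGraphs
  Literature.AlgebraicGeometry.Frobenioids.QuasiTemperoid LogDivisorModel LogDivisorModel.GaloisAction LogDivisorTower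

namespace TateTowerKummerTwist

/-! ## §1 Compactness of `G_K = C` and countability of primes -/

/-- `Mₙ = (n+2)! ≠ 0`. [cite: MochizukiEtTh2009, §1 p.13] -/
theorem neZero_M (n : ℕ) : NeZero (M n) := ⟨Nat.factorial_ne_zero _⟩

/-- **`G_K = C = ∏ₙ (ℤ/Mₙ)ˣ` is compact** (a product of finite discrete groups) — the hypothesis `[CompactSpace G_K]` of the Thm. 3.7 engine
for `D^cnst = 𝓑(G_K)⁰`. [cite: MochizukiFrdII2008, Ex 1.3 (i) p.11] -/
theorem compactSpace_cst : CompactSpace Cst := by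
  haveI : ∀ n, NeZero (M n) := neZero_M
  infer_instance

variable (R S R' S' : ((Discrete PUnit.{1})ᵒᵖ ⥤ CommMonCat.{0}) → Prop)

/-- **`hcnt` at the `Λ = ℝ` rank-one-object Frobenioid of the twisted tower** (countable orbit, no cusps, components `ℤ`).
[cite: MochizukiEtTh2009, Ex 3.9 p.84] -/
theorem countable_primes_perfection_Φ_ofRankOneObjectRC (B : (Discrete PUnit.{1})ᵒᵖ) :
    Countable (Primes (Perfection ↥((TemperedFrobenioid.ofRankOneObjectR rankOneObjectC hpfC R S).Φ.carrier B))) := by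
  haveI := countable_primes_perfection_Φ₀_ofTowerC (op rankOneObjectC.Y₀)
  exact TemperedFrobenioid.countable_primes_perfection_Φ_ofRankOneObjectR rankOneObjectC hpfC R S B

/-! ## §2 Theorem 3.7 (i)–(iv), `Λ = ℝ`, NO binder, non-constant `D^cnst` -/

/-- **[EtTh] Theorem 3.7 (i)–(iv), monoid type `Λ = ℝ`, at the rank-one-object tempered Frobenioid over the ζ-TWISTED Kummer–Tate tower, with
NO binder and with (iii) read through the NON-CONSTANT constant-field functor `cnst : Y ↦ Spec K_Y`**: abc-iut-L2-d2's
`thm37_ofRankOneObjectR_of_inputs` fed `h₀ := prop34Cnst₀_cnst` (abc-iut-w5-d179), `hE := effRealSpan_ofTowerC`, `hcyc := prop34ConstC.hcyc`.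
[cite: MochizukiEtTh2009, Thm 3.7 p.79] -/
theorem thm37_kummerTwistR :
    (PreFrobenioid.IsOfType (PreFrobenioid.IsUnitTrivial (TemperedFrobenioid.ofRankOneObjectR rankOneObjectC hpfC R S).toElem) ∧
      PreFrobenioid.IsOfIsotropicType (TemperedFrobenioid.ofRankOneObjectR rankOneObjectC hpfC R S).toElem ∧
      PreFrobenioid.IsOfModelType (TemperedFrobenioid.ofRankOneObjectR rankOneObjectC hpfC R S).toElem
        ((TemperedFrobenioid.ofRankOneObjectR rankOneObjectC hpfC R S).isFrobenioid_treeCatVocab_of_isMonoidOn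
          (TemperedFrobenioid.isMonoidOn_ratFnFunctor_ofRankOneObjectR rankOneObjectC hpfC R S))
        (PreFrobenioid.hasBiratSquares_of_isFrobenioid
          ((TemperedFrobenioid.ofRankOneObjectR rankOneObjectC hpfC R S).isFrobenioid_treeCatVocab_of_isMonoidOn
            (TemperedFrobenioid.isMonoidOn_ratFnFunctor_ofRankOneObjectR rankOneObjectC hpfC R S))) ∧
      PreFrobenioidData.IsOfBiratFrobeniusNormalizedType
        (PreFrobenioid.biratData
          ((TemperedFrobenioid.ofRankOneObjectR rankOneObjectC hpfC R S).isFrobenioid_treeCatVocab_of_isMonoidOn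
            (TemperedFrobenioid.isMonoidOn_ratFnFunctor_ofRankOneObjectR rankOneObjectC hpfC R S))
          (PreFrobenioid.hasBiratSquares_of_isFrobenioid
            ((TemperedFrobenioid.ofRankOneObjectR rankOneObjectC hpfC R S).isFrobenioid_treeCatVocab_of_isMonoidOn
              (TemperedFrobenioid.isMonoidOn_ratFnFunctor_ofRankOneObjectR rankOneObjectC hpfC R S)))) ∧
      PreFrobenioid.IsOfType
        (PreFrobenioid.IsSubQuasiFrobeniusTrivial (TemperedFrobenioid.ofRankOneObjectR rankOneObjectC hpfC R S).toElem) ∧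
      ¬ PreFrobenioid.IsOfType (PreFrobenioid.IsGroupLikeObj (TemperedFrobenioid.ofRankOneObjectR rankOneObjectC hpfC R S).toElem)) ∧
    ((ModelFrobenioid.data (TemperedFrobenioid.ofRankOneObjectR rankOneObjectC hpfC R S).divisorMonoid
        (TemperedFrobenioid.ofRankOneObjectR rankOneObjectC hpfC R S).ratFnFunctor
        (TemperedFrobenioid.ofRankOneObjectR rankOneObjectC hpfC R S).divBNatTrans).IsOfStandardType ∧
      (PreFrobenioidData.ofFunctor (TemperedFrobenioid.ofRankOneObjectR rankOneObjectC hpfC R S).divisorMonoid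
          (TemperedFrobenioid.ofRankOneObjectR rankOneObjectC hpfC R S).toElem).IsOfRationallyStandardType
        (PreFrobenioid.rsParams
          ((TemperedFrobenioid.ofRankOneObjectR rankOneObjectC hpfC R S).isFrobenioid_treeCatVocab_of_isMonoidOn
            (TemperedFrobenioid.isMonoidOn_ratFnFunctor_ofRankOneObjectR rankOneObjectC hpfC R S))
          fun a 𝔭 => PrimarySupp a 𝔭)) ∧
    (∀ X : (TemperedFrobenioid.ofRankOneObjectR rankOneObjectC hpfC R S).category,
      FrobenioidFacade.AutActionFactorsThrough ((TemperedFrobenioid.ofRankOneObjectR rankOneObjectC hpfC R S).base ⋙ cnst)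
        (TemperedFrobenioid.ofRankOneObjectR rankOneObjectC hpfC R S).toElem X) ∧
    (TemperedFrobenioid.ofRankOneObjectR rankOneObjectC hpfC R S).Thm37_iv := by
  haveI : CompactSpace Cst := compactSpace_cst
  exact TemperedFrobenioid.thm37_ofRankOneObjectR_of_inputs rankOneObjectC hpfC R S cnst prop34Cnst₀_cnst effRealSpan_ofTowerC
    prop34ConstC.hcyc

/-- **[EtTh] Theorem 3.7 (iii), first clause, `Λ = ℝ`, through the NON-CONSTANT `D^cnst`**, isolated: for every object `A` of the twisted-tower
Frobenioid, automorphisms of `A` with the same image in `Aut_{D^cnst}(A^cnst) = Aut(Spec K_{A_D})` conjugate `O^▷(A)` and `O^×(A)` identically.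
[cite: MochizukiEtTh2009, Thm 3.7 (iii) p.79] -/
theorem thm37_iii_kummerTwistR (X : (TemperedFrobenioid.ofRankOneObjectR rankOneObjectC hpfC R S).category) :
    FrobenioidFacade.AutActionFactorsThrough ((TemperedFrobenioid.ofRankOneObjectR rankOneObjectC hpfC R S).base ⋙ cnst)
      (TemperedFrobenioid.ofRankOneObjectR rankOneObjectC hpfC R S).toElem X :=
  (thm37_kummerTwistR R S).2.2.1 X

/-! ## §3 Corollary 3.8 (i) ∧ (ii) ∧ (iii), `Λ = ℝ`, NO binder -/

/-- **[EtTh] Cor. 3.8 (i) ∧ (ii) AS TYPED, `Λ = ℝ`, between two rank-one-object Frobenioids of the ζ-twisted tower, NO binder beyond `h`**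
(`hE := effRealSpan_ofTowerC`, `Prop34Const := prop34ConstC`). [cite: MochizukiEtTh2009, Cor 3.8 p.80] -/
theorem cor38_i_ii_kummerTwistR
    (h : Cor38Hyp (TemperedFrobenioid.ofRankOneObjectR rankOneObjectC hpfC R S) (TemperedFrobenioid.ofRankOneObjectR rankOneObjectC hpfC R' S')) :
    Literature.AnabelianGeometry.EtaleTheta.Cor38_i (fun E _ => Literature.AlgebraicGeometry.Frobenioids.IsFrobeniusSlim E) h ∧
      Literature.AnabelianGeometry.EtaleTheta.Cor38_ii
        (fun E _ Φ => ∀ (B : E) (α : Aut (Over.forget B)),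
          (∀ (B' : Over B) (x : Φ.obj (op B'.left)),
            Literature.AlgebraicGeometry.Frobenioids.pull Φ (α.hom.app B') x = x) → α = 1) h :=
  TemperedFrobenioid.cor38_i_ii_ofRankOneObjectR_ofTower rankOneObjectC hpfC R S rankOneObjectC hpfC R' S' h effRealSpan_ofTowerC
    effRealSpan_ofTowerC prop34ConstC prop34ConstC

/-- **[EtTh] Cor. 3.8 (i) ∧ (ii) ∧ (iii) AS TYPED, `Λ = ℝ`, at the ζ-twisted tower, for every `h`, NO binder beyond `h`** ((iii) = abc-iut-L2-d2's
`Λ = ℝ` apex with `hcnt`, `Prop34Const`, «`C` is a Frobenioid» all theorems here). [cite: MochizukiEtTh2009, Cor 3.8 p.80] -/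
theorem cor38_kummerTwistR
    (h : Cor38Hyp (TemperedFrobenioid.ofRankOneObjectR rankOneObjectC hpfC R S) (TemperedFrobenioid.ofRankOneObjectR rankOneObjectC hpfC R' S')) :
    Literature.AnabelianGeometry.EtaleTheta.Cor38_i (fun E _ => Literature.AlgebraicGeometry.Frobenioids.IsFrobeniusSlim E) h ∧
      Literature.AnabelianGeometry.EtaleTheta.Cor38_ii
        (fun E _ Φ => ∀ (B : E) (α : Aut (Over.forget B)),
          (∀ (B' : Over B) (x : Φ.obj (op B'.left)),
            Literature.AlgebraicGeometry.Frobenioids.pull Φ (α.hom.app B') x = x) → α = 1) h ∧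
      Cor38_iii h :=
  ⟨(cor38_i_ii_kummerTwistR R S R' S' h).1, (cor38_i_ii_kummerTwistR R S R' S' h).2,
    cor38_iii_ofRlfRWeak_of_isFrobenioid_of_countable_of_prop34Const h (countable_primes_perfection_Φ_ofRankOneObjectRC R S)
      (countable_primes_perfection_Φ_ofRankOneObjectRC R' S') prop34ConstC prop34ConstC
      (TemperedFrobenioid.isFrobenioid_ofRankOneObjectR rankOneObjectC hpfC R S)
      (TemperedFrobenioid.isFrobenioid_ofRankOneObjectR rankOneObjectC hpfC R' S')⟩

/-- **The CONCLUSIONS of Cor. 3.8 (i), (ii) and the first clause of (iii), `Λ = ℝ`, at the ζ-twisted tower, for every `h`** (the one-object base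
is slim and Div-slim). [cite: MochizukiEtTh2009, Cor 3.8 p.81] -/
theorem cor38_conclusion_kummerTwistR
    (h : Cor38Hyp (TemperedFrobenioid.ofRankOneObjectR rankOneObjectC hpfC R S) (TemperedFrobenioid.ofRankOneObjectR rankOneObjectC hpfC R' S')) :
    (PreservesBaseFieldTheoretic h ∧
      ∃ Ψbs : (TemperedFrobenioid.ofRankOneObjectR rankOneObjectC hpfC R S).hullCategory ≌
          (TemperedFrobenioid.ofRankOneObjectR rankOneObjectC hpfC R' S').hullCategory,
        Nonempty ((TemperedFrobenioid.ofRankOneObjectR rankOneObjectC hpfC R S).hull ⋙ h.Ψ.functor ≅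
          Ψbs.functor ⋙ (TemperedFrobenioid.ofRankOneObjectR rankOneObjectC hpfC R' S').hull)) ∧
      Cor38_iii h :=
  ⟨(cor38_i_ii_kummerTwistR R S R' S' h).2 (Toy.isDivSlim45iv_discretePUnit _) (Toy.isDivSlim45iv_discretePUnit _),
    (cor38_kummerTwistR R S R' S' h).2.2⟩

/-- **The typed statements of the nodes `EtTh:Cor3.8(i)`, `(ii)`, `(iii)` at `Λ = ℝ` have a SIMULTANEOUS unconditional kernel instance at the
ζ-TWISTED tower** (`Ψ := 𝟭`) — a model whose constant fields carry recorded roots of unity moved by the Galois group.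
[cite: MochizukiEtTh2009, Cor 3.8 p.80] -/
theorem exists_cor38Hyp_cor38_kummerTwistR :
    ∃ h : Cor38Hyp (TemperedFrobenioid.ofRankOneObjectR rankOneObjectC hpfC R S) (TemperedFrobenioid.ofRankOneObjectR rankOneObjectC hpfC R S),
      Literature.AnabelianGeometry.EtaleTheta.Cor38_i (fun E _ => Literature.AlgebraicGeometry.Frobenioids.IsFrobeniusSlim E) h ∧
        Literature.AnabelianGeometry.EtaleTheta.Cor38_ii
          (fun E _ Φ => ∀ (B : E) (α : Aut (Over.forget B)),
            (∀ (B' : Over B) (x : Φ.obj (op B'.left)),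
              Literature.AlgebraicGeometry.Frobenioids.pull Φ (α.hom.app B') x = x) → α = 1) h ∧
        Cor38_iii h := by
  obtain ⟨h⟩ := TemperedFrobenioid.nonempty_cor38Hyp_ofRankOneObjectR rankOneObjectC hpfC R S
  exact ⟨h, cor38_kummerTwistR R S R S h⟩

/-- **[EtTh] Cor. 3.8 (ii) for every self-equivalence of the `Λ = ℝ` twisted-tower Frobenioid, NO binder.** [cite: MochizukiEtTh2009, Cor 3.8 p.81] -/
theorem hull_selfEquivalence_kummerTwistR
    (e : (TemperedFrobenioid.ofRankOneObjectR rankOneObjectC hpfC R S).category ≌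
      (TemperedFrobenioid.ofRankOneObjectR rankOneObjectC hpfC R S).category) :
    (∀ {X Y : (TemperedFrobenioid.ofRankOneObjectR rankOneObjectC hpfC R S).category} (f : X ⟶ Y),
        (TemperedFrobenioid.ofRankOneObjectR rankOneObjectC hpfC R S).IsBaseFieldTheoretic f ↔
          (TemperedFrobenioid.ofRankOneObjectR rankOneObjectC hpfC R S).IsBaseFieldTheoretic (e.functor.map f)) ∧
      ∃ e' : (TemperedFrobenioid.ofRankOneObjectR rankOneObjectC hpfC R S).hullCategory ≌
          (TemperedFrobenioid.ofRankOneObjectR rankOneObjectC hpfC R S).hullCategory,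
        Nonempty ((TemperedFrobenioid.ofRankOneObjectR rankOneObjectC hpfC R S).hull ⋙ e.functor ≅
          e'.functor ⋙ (TemperedFrobenioid.ofRankOneObjectR rankOneObjectC hpfC R S).hull) :=
  TemperedFrobenioid.hull_selfEquivalence_ofRankOneObjectR_ofTower rankOneObjectC hpfC R S effRealSpan_ofTowerC prop34ConstC e

end TateTowerKummerTwist

end Literature.AnabelianGeometry.EtaleTheta

end
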